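import Mathlib
import Summits.Ventures.PercRepro2.BHKEvents
import Summits.Ventures.PercRepro2.BHKOutside
import Summits.Ventures.PercRepro2.SameClusterAvoid
import Summits.Ventures.PercRepro2.OneEdge
import Summits.Ventures.PercRepro2.RBRootEdge

/-!
# Cross-law monotonicity along an `a₂`-edge and the polarised same-cluster BHK inequality
(blind cell PercRepro2, p5 g34; S4 §2.4 (s) addendum 28)

Along an edge `e = {a₂, w}` (`w ≠ a₁`) compare the law of the cluster `K = C(a₂)` conditioned on
`a₂ ↮ a₁` at `e` closed (`p[e ↦ 0]`) and at `e` open (`p[e ↦ 1]`).  Opening `e` grows the cluster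
through `w`: with `Q = {a₂ ↮ a₁}`,
`P_{p[e↦1]}(C(a₂) ∈ 𝓤, Q) = P_{p[e↦0]}(C(a₂) ∪ C(w) ∈ 𝓤, Q, w ↮ a₁)`, and
`P_{p[e↦0]}(Q, w ↮ a₁) = E_{p[e↦0]}[φ(K)·1_Q]` with the INCREASING cluster functional
`φ(S) = [w ∈ S] + [w ∉ S]·P(a₁ ∉ C_{G∖S}(w))` (**`growAvoid`**, `prob_inter_avoidW_eq_expect`).
BHK's same-cluster positive association (`bhk_same_cluster`, functional form) then gives the
**cross-law monotonicity** `P_{p[e↦1]}(C(a₂) ∈ 𝓤 | Q) ≥ P_{p[e↦0]}(C(a₂) ∈ 𝓤 | Q)` for every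
up-set `𝓤` (**`prob_Q_update_mono`**, multiplied out), and with BHK 1.3 at the two pinned
measures the **polarised same-cluster inequality** along the edge (**`bhk_polarised_a2`**):
`Z⁰·t¹ + Z¹·t⁰ ≥ x⁰·y¹ + x¹·y⁰` (`Z = P(Q)`, `x = P(Q, o ∈ K)`, `y = P(Q, b ∈ K)`,
`t = P(Q, o, b ∈ K)`), i.e. the middle Bernstein coefficient of the BHK gap `Z·t − x·y` along
an `a₂`-edge is nonnegative — by the certificate
`Z⁰Z¹·(Z⁰t¹ + Z¹t⁰ − x⁰y¹ − x¹y⁰) = (Z¹)²·(Z⁰t⁰ − x⁰y⁰) + (Z⁰)²·(Z¹t¹ − x¹y¹) + (x¹Z⁰ − x⁰Z¹)·(y¹Z⁰ − y⁰Z¹)`.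
This is the `g ≡ c` case of the open step `A2Step` of `CrossAPrimeA2Induction`.
Own work; standard axioms.
-/

namespace Summit.Ventures.PercRepro2

namespace CrossAPrimeA2Mono

section Grow

variable {V : Type*} {E : Type*} [Fintype E] [DecidableEq E] [Fintype V] [DecidableEq V]
  {R : Type*} [Field R] [LinearOrder R] [IsStrictOrderedRing R]
variable {ends : E → Sym2 V}

open Classical in
/-- The growth functional `φ(S) = [w ∈ S] + [w ∉ S]·P(a₁ ∉ C_{G∖S}(w))`: the probability that
opening an edge from `S` to `w` keeps `a₁` out of the grown cluster. -/
noncomputable def growAvoid (p : E → R) (ends : E → Sym2 V) (w a₁ : V) (S : Set V) : R :=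
  if w ∈ S then 1 else delClusterProb p ends w {A : Set V | a₁ ∉ A} S

omit [Fintype V] [DecidableEq V] in
/-- `0 ≤ φ`. -/
lemma growAvoid_nonneg {p : E → R} (hp : IsProbVec p) (w a₁ : V) (S : Set V) :
    0 ≤ growAvoid p ends w a₁ S := by
  classical
  unfold growAvoid
  split_ifs
  · exact zero_le_one
  · exact delClusterProb_nonneg p hp ends w _ S

omit [Fintype V] [DecidableEq V] in
/-- `P(a₁ ∉ C_{G∖W}(w))` is monotone in the deleted set `W` (the cluster shrinks). -/
lemma delClusterProb_notMem_mono {p : E → R} (hp : IsProbVec p) (w a₁ : V) {W W' : Set V}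
    (h : W ⊆ W') :
    delClusterProb p ends w {A : Set V | a₁ ∉ A} W ≤ delClusterProb p ends w {A : Set V | a₁ ∉ A} W' := by
  unfold delClusterProb
  refine prob_mono hp fun ω hω => ?_
  simp only [Set.mem_setOf_eq] at hω ⊢
  exact fun h1 => hω (cluster_mono (delConfig_anti h ω) w h1)

omit [Fintype V] [DecidableEq V] in
/-- `φ` is an increasing cluster functional. -/
lemma growAvoid_mono {p : E → R} (hp : IsProbVec p) (w a₁ : V) :
    Monotone (growAvoid p ends w a₁) := by
  classical
  intro S S' hSS'
  unfold growAvoid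
  by_cases hS : w ∈ S
  · rw [if_pos hS, if_pos (hSS' hS)]
  · rw [if_neg hS]
    by_cases hS' : w ∈ S'
    · rw [if_pos hS']
      exact delClusterProb_le_one p hp ends w _ S
    · rw [if_neg hS']
      exact delClusterProb_notMem_mono hp w a₁ hSS'

omit [Fintype V] [DecidableEq V] [LinearOrder R] [IsStrictOrderedRing R] in
/-- `φ = [w ∈ ·] + outsideProb`. -/
lemma growAvoid_eq (p : E → R) (w a₁ : V) (S : Set V) :
    growAvoid p ends w a₁ S =
      ({A : Set V | w ∈ A}).indicator 1 S + outsideProb p ends w {A : Set V | a₁ ∉ A} S := by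
  classical
  unfold growAvoid
  by_cases hS : w ∈ S
  · rw [if_pos hS, outsideProb_apply_of_mem p _ hS]
    simp [hS]
  · rw [if_neg hS, outsideProb_apply_of_notMem p _ hS]
    simp [hS]

omit [Fintype E] [DecidableEq E] [Fintype V] [DecidableEq V] [LinearOrder R]
  [IsStrictOrderedRing R] in
/-- `{a₂ ↮ a₁}` as an avoidance. -/
lemma avoidAll_singleton_eq (a₂ a₁ : V) :
    avoidAll ends a₂ {a₁} = (connEvent ends a₂ a₁)ᶜ := by
  ext ω
  simp [avoidAll, connEvent]

omit [LinearOrder R] [IsStrictOrderedRing R] in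
/-- **The growth identity**: `P(C(a₂) ∈ 𝓤, a₂ ↮ a₁, w ↮ a₁) = E[1_𝓤(K)·φ(K)·1_{a₂↮a₁}]`
(spatial Markov: on `{w ∉ K}` the cluster of `w` lives in `G ∖ K`). -/
theorem prob_inter_avoidW_eq_expect (p : E → R) (ends : E → Sym2 V) (a₂ w a₁ : V)
    (𝓤 : Set (Set V)) :
    prob p (clusterInEvent ends a₂ 𝓤 ∩ ((connEvent ends a₂ a₁)ᶜ ∩ (connEvent ends w a₁)ᶜ)) =
      expect p (fun ω => 𝓤.indicator 1 (cluster ends ω a₂) *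
        growAvoid p ends w a₁ (cluster ends ω a₂) * ((connEvent ends a₂ a₁)ᶜ).indicator 1 ω) := by
  classical
  set A := clusterInEvent ends a₂ 𝓤 ∩ ((connEvent ends a₂ a₁)ᶜ ∩ (connEvent ends w a₁)ᶜ) with hA
  have hsplit := prob_inter_add_prob_inter_compl p A (connEvent ends a₂ w)
  -- on `w ∈ K`: `w ↮ a₁` is automatic
  have e1 : A ∩ connEvent ends a₂ w =
      clusterInEvent ends a₂ ({A : Set V | w ∈ A} ∩ 𝓤) ∩ (connEvent ends a₂ a₁)ᶜ := by
    ext ω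
    simp only [hA, Set.mem_inter_iff, mem_clusterInEvent, Set.mem_compl_iff, connEvent,
      Set.mem_setOf_eq, cluster]
    constructor
    · rintro ⟨⟨h1, h2, _⟩, h4⟩
      exact ⟨⟨h4, h1⟩, h2⟩
    · rintro ⟨⟨h4, h1⟩, h2⟩
      exact ⟨⟨h1, h2, fun hw => h2 (conn_trans h4 hw)⟩, h4⟩
  -- on `w ∉ K`: the outside event of `w`
  have e2 : A ∩ (connEvent ends a₂ w)ᶜ =
      clusterInEvent ends a₂ 𝓤 ∩ clusterInEvent ends w {A : Set V | a₁ ∉ A} ∩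
        avoidAll ends a₂ (insert w {a₁}) := by
    ext ω
    simp only [hA, Set.mem_inter_iff, mem_clusterInEvent, Set.mem_compl_iff, connEvent,
      Set.mem_setOf_eq, cluster, mem_avoidAll, Finset.mem_insert, Finset.mem_singleton,
      forall_eq_or_imp, forall_eq]
    tauto
  rw [e1, e2] at hsplit
  rw [← hsplit]
  have h3 := prob_clusterIn_outside_inter_avoid_eq_expect p ends a₂ w {a₁} 𝓤
    {A : Set V | a₁ ∉ A}
  rw [h3, prob_clusterInEvent_inter_eq_expect, ← expect_add]
  refine congrArg (expect p) (funext fun ω => ?_)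
  simp only [Pi.add_apply, growAvoid_eq]
  have hav : (avoidAll ends a₂ {a₁}).indicator (1 : Config E → R) ω =
      ((connEvent ends a₂ a₁)ᶜ).indicator 1 ω := by
    congr 1
    ext ω'
    simp [avoidAll, connEvent]
  rw [hav]
  by_cases h1 : cluster ends ω a₂ ∈ 𝓤 <;> by_cases h2 : w ∈ cluster ends ω a₂ <;>
    by_cases h3 : Conn ends ω a₂ a₁ <;> simp [h1, h2, h3]

end Grow

section Mono

variable {V : Type*} {E : Type*} [Fintype E] [DecidableEq E] [Fintype V] [DecidableEq V]
  {R : Type*} [Field R] [LinearOrder R] [IsStrictOrderedRing R]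
variable {ends : E → Sym2 V}

omit [DecidableEq V] [LinearOrder R] [IsStrictOrderedRing R] in
/-- `P_{p[e↦1]}(S) = P_{p[e↦0]}({ω | ω[e ↦ open] ∈ S})`. -/
lemma prob_update_one_eq_update_zero (p : E → R) (e : E) (S : Set (Config E)) :
    prob (Function.update p e 1) S =
      prob (Function.update p e 0) {ω | Function.update ω e true ∈ S} := by
  rw [RBRootEdge.prob_update_one_eq, RBRootEdge.prob_update_zero_eq]
  congr 1
  ext ω
  simp only [Set.mem_setOf_eq, Function.update_idem]

omit [Fintype E] [Fintype V] [DecidableEq V] [LinearOrder R] [IsStrictOrderedRing R] in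
/-- With `e = {a₂, w}` forced open, `a₂ ↮ a₁` is `a₂ ↮ a₁ ∧ w ↮ a₁`. -/
lemma update_true_notConn_iff {e : E} {a₂ w : V} (he : ends e = s(a₂, w)) (ω : Config E)
    (a₁ : V) :
    ¬ Conn ends (Function.update ω e true) a₂ a₁ ↔ ¬ Conn ends ω a₂ a₁ ∧ ¬ Conn ends ω w a₁ := by
  rw [OneEdge.conn_update_true_iff he ω a₂ a₁]
  constructor
  · intro h
    exact ⟨fun h1 => h (Or.inl h1), fun h2 => h (Or.inr (Or.inl ⟨conn_refl ends ω a₂, h2⟩))⟩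
  · rintro ⟨h1, h2⟩ (h | ⟨_, h⟩ | ⟨_, h⟩)
    · exact h1 h
    · exact h2 h
    · exact h1 h

omit [Fintype V] [DecidableEq V] [LinearOrder R] [IsStrictOrderedRing R] in
/-- `Z¹ = P_{p[e↦0]}(a₂ ↮ a₁, w ↮ a₁)`. -/
lemma prob_update_one_Q_eq {p : E → R} {e : E} {a₂ w : V} (he : ends e = s(a₂, w)) (a₁ : V) :
    prob (Function.update p e 1) (connEvent ends a₂ a₁)ᶜ =
      prob (Function.update p e 0) ((connEvent ends a₂ a₁)ᶜ ∩ (connEvent ends w a₁)ᶜ) := by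
  rw [prob_update_one_eq_update_zero]
  congr 1
  ext ω
  simp only [Set.mem_setOf_eq, Set.mem_compl_iff, connEvent, Set.mem_inter_iff]
  exact update_true_notConn_iff he ω a₁

omit [Fintype V] [DecidableEq V] in
/-- `x¹ ≥ P_{p[e↦0]}(C(a₂) ∈ 𝓤, a₂ ↮ a₁, w ↮ a₁)` for an up-set `𝓤` (the grown cluster contains
the cluster). -/
lemma prob_update_one_Q_inter_ge {p : E → R} (hp : IsProbVec p) {e : E} {a₂ w : V}
    (he : ends e = s(a₂, w)) (a₁ : V) {𝓤 : Set (Set V)} (h𝓤 : IsUpperSet 𝓤) :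
    prob (Function.update p e 0)
        (clusterInEvent ends a₂ 𝓤 ∩ ((connEvent ends a₂ a₁)ᶜ ∩ (connEvent ends w a₁)ᶜ)) ≤
      prob (Function.update p e 1) (clusterInEvent ends a₂ 𝓤 ∩ (connEvent ends a₂ a₁)ᶜ) := by
  rw [prob_update_one_eq_update_zero]
  refine prob_mono (hp.update e le_rfl zero_le_one) fun ω hω => ?_
  simp only [Set.mem_inter_iff, mem_clusterInEvent, Set.mem_compl_iff, connEvent,
    Set.mem_setOf_eq] at hω ⊢
  obtain ⟨h1, h2, h3⟩ := hω
  refine ⟨h𝓤 (cluster_mono (OneEdge.le_update_true ω e) a₂) h1, ?_⟩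
  exact (update_true_notConn_iff he ω a₁).2 ⟨h2, h3⟩

/-- **Cross-law monotonicity along an `a₂`-edge**: for every up-set `𝓤`,
`P_{p[e↦0]}(C(a₂) ∈ 𝓤, Q) · P_{p[e↦1]}(Q) ≤ P_{p[e↦1]}(C(a₂) ∈ 𝓤, Q) · P_{p[e↦0]}(Q)`
(`Q = {a₂ ↮ a₁}`): opening an edge at `a₂` raises the conditional probability of every increasing
event of the cluster. -/
theorem prob_Q_update_mono {p : E → R} (hp : IsProbVec p) {e : E} {a₂ w : V}
    (he : ends e = s(a₂, w)) (a₁ : V) {𝓤 : Set (Set V)} (h𝓤 : IsUpperSet 𝓤) :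
    prob (Function.update p e 0) (clusterInEvent ends a₂ 𝓤 ∩ (connEvent ends a₂ a₁)ᶜ) *
        prob (Function.update p e 1) (connEvent ends a₂ a₁)ᶜ ≤
      prob (Function.update p e 1) (clusterInEvent ends a₂ 𝓤 ∩ (connEvent ends a₂ a₁)ᶜ) *
        prob (Function.update p e 0) (connEvent ends a₂ a₁)ᶜ := by
  classical
  set p₀ := Function.update p e 0 with hp₀
  have hp0 : IsProbVec p₀ := hp.update e le_rfl zero_le_one
  have hF₁ : Monotone (𝓤.indicator (1 : Set V → R)) := monotone_indicator_one_of_isUpperSet h𝓤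
  have hF₁0 : ∀ W, 0 ≤ 𝓤.indicator (1 : Set V → R) W :=
    fun W => Set.indicator_apply_nonneg fun _ => zero_le_one
  have key := bhk_same_cluster p₀ hp0 ends a₂ a₁ (F₂ := growAvoid p₀ ends w a₁) hF₁
    (growAvoid_mono (ends := ends) hp0 w a₁) hF₁0 (growAvoid_nonneg (ends := ends) hp0 w a₁)
  -- the four expectations
  have e1 : expect p₀ (fun ω => 𝓤.indicator 1 (cluster ends ω a₂) *
      ((connEvent ends a₂ a₁)ᶜ).indicator 1 ω) =
      prob p₀ (clusterInEvent ends a₂ 𝓤 ∩ (connEvent ends a₂ a₁)ᶜ) :=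
    (prob_clusterInEvent_inter_eq_expect p₀ ends a₂ 𝓤 _).symm
  have e2 : expect p₀ (fun ω => growAvoid p₀ ends w a₁ (cluster ends ω a₂) *
      ((connEvent ends a₂ a₁)ᶜ).indicator 1 ω) =
      prob (Function.update p e 1) (connEvent ends a₂ a₁)ᶜ := by
    rw [prob_update_one_Q_eq he a₁]
    have h := prob_inter_avoidW_eq_expect p₀ ends a₂ w a₁ Set.univ
    have e : clusterInEvent ends a₂ Set.univ ∩ ((connEvent ends a₂ a₁)ᶜ ∩ (connEvent ends w a₁)ᶜ) =
        (connEvent ends a₂ a₁)ᶜ ∩ (connEvent ends w a₁)ᶜ := by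
      ext ω; simp [clusterInEvent]
    rw [e] at h
    rw [h]
    refine congrArg (expect p₀) (funext fun ω => ?_)
    simp
  have e3 : expect p₀ (fun ω => 𝓤.indicator 1 (cluster ends ω a₂) *
      growAvoid p₀ ends w a₁ (cluster ends ω a₂) * ((connEvent ends a₂ a₁)ᶜ).indicator 1 ω) ≤
      prob (Function.update p e 1) (clusterInEvent ends a₂ 𝓤 ∩ (connEvent ends a₂ a₁)ᶜ) := by
    rw [← prob_inter_avoidW_eq_expect p₀ ends a₂ w a₁ 𝓤]
    exact prob_update_one_Q_inter_ge hp he a₁ h𝓤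
  rw [e1, e2] at key
  have hZ0 : 0 ≤ prob p₀ (connEvent ends a₂ a₁)ᶜ := prob_nonneg hp0 _
  calc prob p₀ (clusterInEvent ends a₂ 𝓤 ∩ (connEvent ends a₂ a₁)ᶜ) *
        prob (Function.update p e 1) (connEvent ends a₂ a₁)ᶜ
      ≤ expect p₀ (fun ω => 𝓤.indicator 1 (cluster ends ω a₂) *
          growAvoid p₀ ends w a₁ (cluster ends ω a₂) * ((connEvent ends a₂ a₁)ᶜ).indicator 1 ω) *
          prob p₀ (connEvent ends a₂ a₁)ᶜ := key
    _ ≤ prob (Function.update p e 1) (clusterInEvent ends a₂ 𝓤 ∩ (connEvent ends a₂ a₁)ᶜ) *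
          prob p₀ (connEvent ends a₂ a₁)ᶜ := mul_le_mul_of_nonneg_right e3 hZ0

end Mono

section Polarised

variable {V : Type*} {E : Type*} [Fintype E] [DecidableEq E] [Fintype V] [DecidableEq V]
  {R : Type*} [Field R] [LinearOrder R] [IsStrictOrderedRing R]
variable {ends : E → Sym2 V}

omit [Fintype E] [DecidableEq E] [Fintype V] [DecidableEq V] [LinearOrder R]
  [IsStrictOrderedRing R] in
/-- `{o ∈ C(a₂)}` as a cluster event. -/
lemma connEvent_eq_clusterInEvent (a₂ o : V) :
    connEvent ends a₂ o = clusterInEvent ends a₂ {A : Set V | o ∈ A} := by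
  ext ω
  simp [connEvent, clusterInEvent, cluster]

omit [Fintype E] [DecidableEq E] [Fintype V] [DecidableEq V] [LinearOrder R]
  [IsStrictOrderedRing R] in
/-- `{o ∈ C(a₂), b ∈ C(a₂)}` as a cluster event. -/
lemma connEvent_inter_eq_clusterInEvent (a₂ o b : V) :
    connEvent ends a₂ o ∩ connEvent ends a₂ b =
      clusterInEvent ends a₂ ({A : Set V | o ∈ A} ∩ {A : Set V | b ∈ A}) := by
  ext ω
  simp [connEvent, clusterInEvent, cluster]

omit [Fintype E] [DecidableEq E] [Fintype V] [DecidableEq V] [LinearOrder R]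
  [IsStrictOrderedRing R] in
/-- `{o ∈ ·}` is an up-set. -/
lemma isUpperSet_mem (o : V) : IsUpperSet {A : Set V | o ∈ A} := fun _ _ h ho => h ho

/-- **BHK 1.3 along an `a₂`-edge, polarised**: with `Z = P(Q)`, `x = P(Q, o ∈ K)`,
`y = P(Q, b ∈ K)`, `t = P(Q, o, b ∈ K)` at `e` closed (`⁰`) and open (`¹`),
`x⁰·y¹ + x¹·y⁰ ≤ Z⁰·t¹ + Z¹·t⁰`: the middle Bernstein coefficient of the BHK gap `Z·t − x·y`
along the edge is nonnegative. -/
theorem bhk_polarised_a2 {p : E → R} (hp : IsProbVec p) {e : E} {a₂ w : V}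
    (he : ends e = s(a₂, w)) (a₁ o b : V) :
    prob (Function.update p e 0) (avoidAll ends a₂ {a₁} ∩ connEvent ends a₂ o) *
          prob (Function.update p e 1) (avoidAll ends a₂ {a₁} ∩ connEvent ends a₂ b) +
        prob (Function.update p e 1) (avoidAll ends a₂ {a₁} ∩ connEvent ends a₂ o) *
          prob (Function.update p e 0) (avoidAll ends a₂ {a₁} ∩ connEvent ends a₂ b) ≤
      prob (Function.update p e 0) (avoidAll ends a₂ {a₁}) *
          prob (Function.update p e 1)
            (avoidAll ends a₂ {a₁} ∩ (connEvent ends a₂ o ∩ connEvent ends a₂ b)) +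
        prob (Function.update p e 1) (avoidAll ends a₂ {a₁}) *
          prob (Function.update p e 0)
            (avoidAll ends a₂ {a₁} ∩ (connEvent ends a₂ o ∩ connEvent ends a₂ b)) := by
  classical
  have hp0 : IsProbVec (Function.update p e 0) := hp.update e le_rfl zero_le_one
  have hp1 : IsProbVec (Function.update p e 1) := hp.update e zero_le_one le_rfl
  -- set identities to align the statements
  have co : clusterInEvent ends a₂ {A : Set V | o ∈ A} ∩ avoidAll ends a₂ {a₁} =
      avoidAll ends a₂ {a₁} ∩ connEvent ends a₂ o := by
    rw [← connEvent_eq_clusterInEvent, Set.inter_comm]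
  have cb : clusterInEvent ends a₂ {A : Set V | b ∈ A} ∩ avoidAll ends a₂ {a₁} =
      avoidAll ends a₂ {a₁} ∩ connEvent ends a₂ b := by
    rw [← connEvent_eq_clusterInEvent, Set.inter_comm]
  have cob : clusterInEvent ends a₂ ({A : Set V | o ∈ A} ∩ {A : Set V | b ∈ A}) ∩
      avoidAll ends a₂ {a₁} =
      avoidAll ends a₂ {a₁} ∩ (connEvent ends a₂ o ∩ connEvent ends a₂ b) := by
    rw [← connEvent_inter_eq_clusterInEvent, Set.inter_comm]
  have co' : clusterInEvent ends a₂ {A : Set V | o ∈ A} ∩ (connEvent ends a₂ a₁)ᶜ =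
      avoidAll ends a₂ {a₁} ∩ connEvent ends a₂ o := by
    rw [← avoidAll_singleton_eq, co]
  have cb' : clusterInEvent ends a₂ {A : Set V | b ∈ A} ∩ (connEvent ends a₂ a₁)ᶜ =
      avoidAll ends a₂ {a₁} ∩ connEvent ends a₂ b := by
    rw [← avoidAll_singleton_eq, cb]
  have cQ : (connEvent ends a₂ a₁)ᶜ = avoidAll ends a₂ {a₁} := (avoidAll_singleton_eq a₂ a₁).symm
  -- BHK 1.3 at the two pinned measures
  have hB0 := bhk_same_cluster_events_avoid (Function.update p e 0) hp0 ends a₂ {a₁}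
    (isUpperSet_mem (V := V) o) (isUpperSet_mem (V := V) b)
  have hB1 := bhk_same_cluster_events_avoid (Function.update p e 1) hp1 ends a₂ {a₁}
    (isUpperSet_mem (V := V) o) (isUpperSet_mem (V := V) b)
  rw [co, cb, cob] at hB0 hB1
  -- cross-law monotonicity for `o` and for `b`
  have hMo := prob_Q_update_mono hp he a₁ (isUpperSet_mem (V := V) o)
  have hMb := prob_Q_update_mono hp he a₁ (isUpperSet_mem (V := V) b)
  rw [co', cQ] at hMo
  rw [cb', cQ] at hMb
  -- names
  set Z0 := prob (Function.update p e 0) (avoidAll ends a₂ {a₁}) with hZ0def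
  set Z1 := prob (Function.update p e 1) (avoidAll ends a₂ {a₁}) with hZ1def
  set x0 := prob (Function.update p e 0) (avoidAll ends a₂ {a₁} ∩ connEvent ends a₂ o)
  set x1 := prob (Function.update p e 1) (avoidAll ends a₂ {a₁} ∩ connEvent ends a₂ o)
  set y0 := prob (Function.update p e 0) (avoidAll ends a₂ {a₁} ∩ connEvent ends a₂ b)
  set y1 := prob (Function.update p e 1) (avoidAll ends a₂ {a₁} ∩ connEvent ends a₂ b)
  set t0 := prob (Function.update p e 0)
    (avoidAll ends a₂ {a₁} ∩ (connEvent ends a₂ o ∩ connEvent ends a₂ b))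
  set t1 := prob (Function.update p e 1)
    (avoidAll ends a₂ {a₁} ∩ (connEvent ends a₂ o ∩ connEvent ends a₂ b))
  have hZ0 : 0 ≤ Z0 := prob_nonneg hp0 _
  have hZ1 : 0 ≤ Z1 := prob_nonneg hp1 _
  have hx0 : x0 ≤ Z0 := prob_mono hp0 Set.inter_subset_left
  have hy0 : y0 ≤ Z0 := prob_mono hp0 Set.inter_subset_left
  have ht0 : t0 ≤ Z0 := prob_mono hp0 Set.inter_subset_left
  have hx1 : x1 ≤ Z1 := prob_mono hp1 Set.inter_subset_left
  have hy1 : y1 ≤ Z1 := prob_mono hp1 Set.inter_subset_left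
  have ht1 : t1 ≤ Z1 := prob_mono hp1 Set.inter_subset_left
  have hx0' : 0 ≤ x0 := prob_nonneg hp0 _
  have hy0' : 0 ≤ y0 := prob_nonneg hp0 _
  have ht0' : 0 ≤ t0 := prob_nonneg hp0 _
  have hx1' : 0 ≤ x1 := prob_nonneg hp1 _
  have hy1' : 0 ≤ y1 := prob_nonneg hp1 _
  have ht1' : 0 ≤ t1 := prob_nonneg hp1 _
  -- the certificate
  have key : Z0 * Z1 * (Z0 * t1 + Z1 * t0 - x0 * y1 - x1 * y0) =
      Z1 ^ 2 * (t0 * Z0 - x0 * y0) + Z0 ^ 2 * (t1 * Z1 - x1 * y1) +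
        (x1 * Z0 - x0 * Z1) * (y1 * Z0 - y0 * Z1) := by ring
  have hA0 : 0 ≤ t0 * Z0 - x0 * y0 := by linarith
  have hA1 : 0 ≤ t1 * Z1 - x1 * y1 := by linarith
  have hMo' : 0 ≤ x1 * Z0 - x0 * Z1 := by linarith
  have hMb' : 0 ≤ y1 * Z0 - y0 * Z1 := by linarith
  have hprod : 0 ≤ Z0 * Z1 * (Z0 * t1 + Z1 * t0 - x0 * y1 - x1 * y0) := by
    rw [key]
    have := mul_nonneg hMo' hMb'
    have := mul_nonneg (sq_nonneg Z1) hA0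
    have := mul_nonneg (sq_nonneg Z0) hA1
    linarith
  rcases hZ0.lt_or_eq with hZ0p | hZ0z
  · rcases hZ1.lt_or_eq with hZ1p | hZ1z
    · have hpos : 0 < Z0 * Z1 := mul_pos hZ0p hZ1p
      have := (mul_nonneg_iff_of_pos_left hpos).1 hprod
      linarith
    · -- `Z¹ = 0`: every `p[e↦1]`-mass vanishes
      have hx1z : x1 = 0 := le_antisymm (by rw [← hZ1z] at hx1; exact hx1) hx1'
      have hy1z : y1 = 0 := le_antisymm (by rw [← hZ1z] at hy1; exact hy1) hy1'
      have ht1z : t1 = 0 := le_antisymm (by rw [← hZ1z] at ht1; exact ht1) ht1'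
      rw [← hZ1z, hx1z, hy1z, ht1z]
      simp
  · -- `Z⁰ = 0`: every `p[e↦0]`-mass vanishes
    have hx0z : x0 = 0 := le_antisymm (by rw [← hZ0z] at hx0; exact hx0) hx0'
    have hy0z : y0 = 0 := le_antisymm (by rw [← hZ0z] at hy0; exact hy0) hy0'
    have ht0z : t0 = 0 := le_antisymm (by rw [← hZ0z] at ht0; exact ht0) ht0'
    rw [← hZ0z, hx0z, hy0z, ht0z]
    simp

end Polarised

end CrossAPrimeA2Mono

end Summit.Ventures.PercRepro2
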